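import Literature.MathematicalPhysics.QuantumLattice.ShellDecompositionProofs
import Literature.MathematicalPhysics.QuantumLattice.CentredLTQOProofs
import Literature.MathematicalPhysics.QuantumLattice.QuasiLocalPiecesProofs
import Literature.MathematicalPhysics.QuantumLattice.LTQORelativeBoundProofs
import Literature.MathematicalPhysics.QuantumLattice.StabilityTorusGeometryProofs
import HarnessLib

/-!
# The relative bound for the shell decomposition (MZ13 Lemma 4 and Proposition 2)

Twenty-second file of the formalisation of the Michalakis–Zwolak stability theorem (hubbard.S19):
Michalakis–Zwolak, arXiv:1109.1588 §6, Lemma 4 ("`W_u := (1 − P₀) X̃_u (1 − P₀)` is a `(J, w)`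
perturbation satisfying `W_u(r) P_{b_u(r)} = 0`") combined with Proposition 2 (the relative bound
`|⟨ψ, W ψ⟩| ≤ β ⟨ψ, H₀ ψ⟩`), in the shell formulation of `ShellDecompositionProofs`: for a
frustration-free projector interaction with LTQO and local gap, and a family `Y_u` of Hermitian
perturbations commuting with the ground-state projector `P₀`, uniformly centred at `u` with
tails `E`, `‖Y_u‖ ≤ N`, `‖P₀ Y_u P₀‖ ≤ δ₀`:

* `norm_shellPiece_le` — the shell pieces `E^u_p Y_u E^u_r` (`E^u_k` the shells of the chain
  `P_{b_u(r₀+k)}`) have norm `≤ n_{max p r}`, `n_0 = 2N`,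
  `n_j = 2(δ₀ + 2E((j−1)/2) + N √(2Δ(j−1−(j−1)/2)))` (local indistinguishability,
  `norm_localGroundProj_mul_centred_le`);
* `norm_inner_shellSum_le` — the quadratic form of `Σ_u Σ_{p,r ≤ M} E^u_p Y_u E^u_r` is at most
  `β ⟨x, H₀ x⟩`, `β = Σ_{j ≤ M} (2j+2)(2(r₀+j)+1)^d n_j / γ(r₀+j)`: each piece is annihilated on
  both sides by `P_{b_u(r₀+max p r)}` so its form is bounded by the local gap form
  (`IsProjectorInteraction.re_inner_localHamiltonian_ge`), and the balls of a fixed radius cover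
  each interaction term at most `(2(r₀+j)+1)^d` times (`sum_re_inner_localHamiltonian_le`,
  `card_filter_subset_cellBall_le` of `StabilityTorusGeometryProofs`); `sum_sum_max_le` regroups the double sum by `max p r`.

No definitions, no named facts (theorems only).
-/

noncomputable section

open Matrix Complex Finset
open scoped Matrix Matrix.Norms.L2Operator

namespace Literature.MathematicalPhysics.QuantumLattice

/-! ### MZ13 Lemma 4 + Proposition 2: the relative bound for the shell decomposition -/

section ShellRelativeBound

open Finset Literature.Probability.LatticeModels
open scoped InnerProductSpace

variable {d L : ℕ} [NeZero L] {κ : Type*} [Fintype κ] [DecidableEq κ] {q : ℕ}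

/-- **Norm of a shell piece** `E^u_p Y E^u_r`, `E^u_k` the shells of the chain
`Q_k = P_{b_u(r₀+k)}`, for a Hermitian `Y` centred at `u` (radius `r₀`, tails `E`) commuting with
`P₀` with `‖P₀ Y P₀‖ ≤ δ₀`, `‖Y‖ ≤ N`: with `j = max p r`,
`‖E_p Y E_r‖ ≤ 2 (δ₀ + 2 E((j−1)/2) + N √(2Δ(j−1−(j−1)/2)))` for `j ≥ 1`, and `≤ 2N` for `j = 0`
(MZ13 Lemma 4, via `norm_localGroundProj_mul_centred_le`). [folklore] -/
theorem norm_shellPiece_le {Φ : Interaction (TorusSite d L × κ) q} {Δ : ℕ → ℝ}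
    (hLTQO : HasLTQO Φ Δ) (hΔ0 : ∀ ℓ, 0 ≤ Δ ℓ)
    (hP0 : ‖localGroundProj Φ (univ : Finset (TorusSite d L × κ))‖ = 1)
    {u : TorusSite d L} {r₀ : ℕ} {Y : Op (TorusSite d L × κ) q} (hY : Y.IsHermitian)
    (hcomm : localGroundProj Φ univ * Y = Y * localGroundProj Φ univ)
    {E : ℕ → ℝ} (hE0 : ∀ m, 0 ≤ E m) (hcent : ∀ m' : ℕ, ‖Y - twirl (cellBall u (r₀ + m'))ᶜ Y‖ ≤ E m')
    {δ₀ N : ℝ} (hδ₀ : ‖localGroundProj Φ univ * Y * localGroundProj Φ univ‖ ≤ δ₀) (hN : ‖Y‖ ≤ N)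
    (p r : ℕ) :
    ‖(if p = 0 then 1 - localGroundProj Φ (cellBall u (r₀ + 0)) else
        localGroundProj Φ (cellBall u (r₀ + (p - 1))) - localGroundProj Φ (cellBall u (r₀ + p))) * Y *
      (if r = 0 then 1 - localGroundProj Φ (cellBall u (r₀ + 0)) else
        localGroundProj Φ (cellBall u (r₀ + (r - 1))) - localGroundProj Φ (cellBall u (r₀ + r)))‖ ≤
      (if max p r = 0 then 2 * N else
        2 * (δ₀ + 2 * E ((max p r - 1) / 2) + N * Real.sqrt (2 * Δ (max p r - 1 - (max p r - 1) / 2)))) := by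
  set Q : ℕ → Op (TorusSite d L × κ) q := fun k => localGroundProj Φ (cellBall u (r₀ + k)) with hQ
  obtain ⟨hQn, hQn'⟩ := localGroundProj_chain_nested Φ u r₀
  have hQh : ∀ k, (Q k).IsHermitian := fun k => localGroundProj_isHermitian Φ _
  have hN0 : 0 ≤ N := (norm_nonneg _).trans hN
  have hδ₀0 : 0 ≤ δ₀ := (norm_nonneg _).trans hδ₀
  -- the bound for `‖Q_k Y‖`, `k` arbitrary: `≤ δ₀ + 2E(k/2) + N √(2Δ(k − k/2))`
  have hQY : ∀ k : ℕ, ‖Q k * Y‖ ≤ δ₀ + 2 * E (k / 2) + N * Real.sqrt (2 * Δ (k - k / 2)) := by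
    intro k
    by_cases hk : 2 * (r₀ + k) < L
    · have h := norm_localGroundProj_mul_centred_le hLTQO (x := u) (r₀ := r₀) (m := k / 2)
        (ℓ := k - k / 2) (by omega) (hΔ0 _) hP0 hY hcomm hcent (B' := cellBall u (r₀ + k))
        (cellBall_mono u (by omega))
      refine h.trans ?_
      have : ‖Y‖ * Real.sqrt (2 * Δ (k - k / 2)) ≤ N * Real.sqrt (2 * Δ (k - k / 2)) :=
        mul_le_mul_of_nonneg_right hN (Real.sqrt_nonneg _)
      linarith
    · rw [hQ]
      simp only
      rw [norm_localGroundProj_mul_eq_of_large (by omega) hY hcomm]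
      have h1 : 0 ≤ 2 * E (k / 2) := by have := hE0 (k / 2); linarith
      have h2 : 0 ≤ N * Real.sqrt (2 * Δ (k - k / 2)) := mul_nonneg hN0 (Real.sqrt_nonneg _)
      linarith
  -- `‖E_j Y‖ ≤ bound_j`
  have hEY : ∀ j : ℕ, ‖(if j = 0 then 1 - Q 0 else Q (j - 1) - Q j) * Y‖ ≤
      (if j = 0 then 2 * N else
        2 * (δ₀ + 2 * E ((j - 1) / 2) + N * Real.sqrt (2 * Δ (j - 1 - (j - 1) / 2)))) := by
    intro j
    refine (norm_shell_mul_le (Q := Q) j Y).trans ?_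
    by_cases hj : j = 0
    · subst hj
      rw [if_pos rfl, if_pos rfl]
      have : ‖Q 0 * Y‖ ≤ ‖Y‖ := by
        calc ‖Q 0 * Y‖ ≤ ‖Q 0‖ * ‖Y‖ := norm_mul_le _ _
          _ ≤ 1 * ‖Y‖ := mul_le_mul_of_nonneg_right
              (norm_le_one_of_isHermitian_of_isIdempotentElem (hQh 0)
                (localGroundProj_idempotent Φ _).eq) (norm_nonneg _)
          _ = ‖Y‖ := one_mul _
      linarith
    · rw [if_neg hj, if_neg hj]
      have h1 := hQY (j - 1)
      have h2 : ‖Q j * Y‖ ≤ ‖Q (j - 1) * Y‖ := by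
        calc ‖Q j * Y‖ = ‖Q j * Q (j - 1) * Y‖ := by rw [hQn (j - 1) j (by omega)]
          _ ≤ ‖Q j‖ * ‖Q (j - 1) * Y‖ := by rw [Matrix.mul_assoc]; exact norm_mul_le _ _
          _ ≤ 1 * ‖Q (j - 1) * Y‖ := mul_le_mul_of_nonneg_right
              (norm_le_one_of_isHermitian_of_isIdempotentElem (hQh j)
                (localGroundProj_idempotent Φ _).eq) (norm_nonneg _)
          _ = _ := one_mul _
      linarith
  -- symmetric version `‖Y E_j‖ = ‖E_j Y‖`
  have hYE : ∀ j : ℕ, ‖Y * (if j = 0 then 1 - Q 0 else Q (j - 1) - Q j)‖ =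
      ‖(if j = 0 then 1 - Q 0 else Q (j - 1) - Q j) * Y‖ := fun j =>
    (norm_proj_mul_eq_norm_mul_proj hY (shell_isHermitian hQh j)).symm
  -- conclude according to which of `p`, `r` is the maximum
  change ‖(if p = 0 then 1 - Q 0 else Q (p - 1) - Q p) * Y * (if r = 0 then 1 - Q 0 else Q (r - 1) - Q r)‖ ≤ _
  rcases le_total p r with hpr | hrp
  · rw [max_eq_right hpr]
    calc _ ≤ ‖Y * (if r = 0 then 1 - Q 0 else Q (r - 1) - Q r)‖ := norm_doubleShell_le' hQn hQn' hQh p r Y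
      _ = _ := hYE r
      _ ≤ _ := hEY r
  · rw [max_eq_left hrp]
    calc _ ≤ ‖(if p = 0 then 1 - Q 0 else Q (p - 1) - Q p) * Y‖ := norm_doubleShell_le hQn hQn' hQh p r Y
      _ ≤ _ := hEY p

end ShellRelativeBound

/-! ### The relative bound for the full shell decomposition (MZ13 Lemma 4 + Proposition 2) -/

section ShellRelativeBoundMain

open Finset Literature.Probability.LatticeModels
open scoped InnerProductSpace

variable {d L : ℕ} [NeZero L] {κ : Type*} [Fintype κ] [DecidableEq κ] {q : ℕ}

/-- Regrouping a double sum by the maximum of the indices: for `f ≥ 0`,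
`Σ_{p,r ≤ M} f(max p r) c_{p,r} ≤ Σ_{j ≤ M} (2j+2) f j C_j` whenever `c_{p,r} ≤ C_{max p r}`… in the
simple form used here: `Σ_{p,r ≤ M} g (max p r) ≤ Σ_{j ≤ M} (2j + 2) g j` for `g ≥ 0`. [folklore] -/
theorem sum_sum_max_le {g : ℕ → ℝ} (hg : ∀ j, 0 ≤ g j) (M : ℕ) :
    ∑ p ∈ range (M + 1), ∑ r ∈ range (M + 1), g (max p r) ≤
      ∑ j ∈ range (M + 1), (2 * (j : ℝ) + 2) * g j := by
  -- `g (max p r) ≤ [p = max] g p + [r = max] g r`, then sum each part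
  have hpt : ∀ p r : ℕ, g (max p r) ≤ (if r ≤ p then g p else 0) + (if p ≤ r then g r else 0) := by
    intro p r
    rcases le_total r p with h | h
    · rw [max_eq_left h, if_pos h]
      have : 0 ≤ (if p ≤ r then g r else 0) := by split_ifs <;> simp [hg]
      linarith
    · rw [max_eq_right h, if_pos h]
      have : 0 ≤ (if r ≤ p then g p else 0) := by split_ifs <;> simp [hg]
      linarith
  have h1 : ∀ p ∈ range (M + 1), ∑ r ∈ range (M + 1), (if r ≤ p then g p else 0) ≤ ((p : ℝ) + 1) * g p := by
    intro p hp
    rw [mem_range] at hp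
    calc ∑ r ∈ range (M + 1), (if r ≤ p then g p else 0)
        = ∑ r ∈ (range (M + 1)).filter (fun r => r ≤ p), g p := by rw [sum_filter]
      _ = (#((range (M + 1)).filter (fun r => r ≤ p)) : ℝ) * g p := by rw [sum_const, nsmul_eq_mul]
      _ ≤ ((p : ℝ) + 1) * g p := by
          refine mul_le_mul_of_nonneg_right ?_ (hg p)
          have : (range (M + 1)).filter (fun r => r ≤ p) ⊆ range (p + 1) := by
            intro r hr; simp only [mem_filter, mem_range] at hr ⊢; omega
          exact_mod_cast (card_le_card this).trans (card_range _).le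
  have h2 : ∀ r ∈ range (M + 1), ∑ p ∈ range (M + 1), (if p ≤ r then g r else 0) ≤ ((r : ℝ) + 1) * g r := by
    intro r hr
    calc ∑ p ∈ range (M + 1), (if p ≤ r then g r else 0)
        = ∑ p ∈ (range (M + 1)).filter (fun p => p ≤ r), g r := by rw [sum_filter]
      _ = (#((range (M + 1)).filter (fun p => p ≤ r)) : ℝ) * g r := by rw [sum_const, nsmul_eq_mul]
      _ ≤ ((r : ℝ) + 1) * g r := by
          refine mul_le_mul_of_nonneg_right ?_ (hg r)
          have : (range (M + 1)).filter (fun p => p ≤ r) ⊆ range (r + 1) := by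
            intro p hp; simp only [mem_filter, mem_range] at hp ⊢; omega
          exact_mod_cast (card_le_card this).trans (card_range _).le
  calc ∑ p ∈ range (M + 1), ∑ r ∈ range (M + 1), g (max p r)
      ≤ ∑ p ∈ range (M + 1), ∑ r ∈ range (M + 1),
          ((if r ≤ p then g p else 0) + (if p ≤ r then g r else 0)) :=
        sum_le_sum fun p _ => sum_le_sum fun r _ => hpt p r
    _ = (∑ p ∈ range (M + 1), ∑ r ∈ range (M + 1), (if r ≤ p then g p else 0)) +
        ∑ p ∈ range (M + 1), ∑ r ∈ range (M + 1), (if p ≤ r then g r else 0) := by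
        rw [← sum_add_distrib]
        exact sum_congr rfl fun p _ => sum_add_distrib
    _ = (∑ p ∈ range (M + 1), ∑ r ∈ range (M + 1), (if r ≤ p then g p else 0)) +
        ∑ r ∈ range (M + 1), ∑ p ∈ range (M + 1), (if p ≤ r then g r else 0) := by
        congr 1
        exact sum_comm
    _ ≤ ∑ p ∈ range (M + 1), ((p : ℝ) + 1) * g p + ∑ r ∈ range (M + 1), ((r : ℝ) + 1) * g r :=
        add_le_add (sum_le_sum h1) (sum_le_sum h2)
    _ = ∑ j ∈ range (M + 1), (2 * (j : ℝ) + 2) * g j := by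
        rw [← sum_add_distrib]; refine sum_congr rfl fun j _ => by ring

/-- **The relative bound for the shell decomposition (MZ13 Lemma 4 with Proposition 2).** For a
frustration-free projector interaction `Φ` with LTQO (rate `Δ ≥ 0`) and local gap `γ(·) > 0` on a
decorated torus, and a family `Y_u` of Hermitian perturbations commuting with the ground-state
projector `P₀`, uniformly centred (radius `r₀`, tails `E`), with `‖Y_u‖ ≤ N` and
`‖P₀ Y_u P₀‖ ≤ δ₀`: the quadratic form of the full double-shell sum
`Σ_u Σ_{p,r ≤ M} E^u_p Y_u E^u_r` (= `Σ_u (1 − P₀) Y_u (1 − P₀)` when `b_u(r₀+M) = Λ`) is bounded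
by `β · ⟨x, H₀ x⟩` with
`β = Σ_{j ≤ M} (2j+2) (2(r₀+j)+1)^d n_j / γ(r₀+j)`, `n_0 = 2N`,
`n_j = 2(δ₀ + 2E((j−1)/2) + N√(2Δ(j−1−(j−1)/2)))` — every shell piece is annihilated on both
sides by the local ground-state projector of `b_u(r₀ + max p r)`, so its form is controlled by
the local gap (`IsProjectorInteraction.re_inner_localHamiltonian_ge`) and the balls of a fixed
radius cover each interaction term at most `(2(r₀+j)+1)^d` times
(`sum_re_inner_localHamiltonian_le`). [cite: MichalakisZwolakCMP2013, §6 Lemma 4 and Prop. 2 (arXiv:1109.1588 pp. 12–15)] -/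
theorem norm_inner_shellSum_le {Φ : Interaction (TorusSite d L × κ) q} (hΦ : IsProjectorInteraction Φ)
    (hΦ0 : Φ ∅ = 0) {Δ : ℕ → ℝ} (hLTQO : HasLTQO Φ Δ) (hΔ0 : ∀ ℓ, 0 ≤ Δ ℓ)
    (hP0 : ‖localGroundProj Φ (univ : Finset (TorusSite d L × κ))‖ = 1)
    {γloc : ℕ → ℝ} (hgap : HasLocalGap Φ γloc) (hγ : ∀ r, 0 < γloc r)
    (r₀ M : ℕ) {Y : TorusSite d L → Op (TorusSite d L × κ) q} (hY : ∀ u, (Y u).IsHermitian)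
    (hcomm : ∀ u, localGroundProj Φ univ * Y u = Y u * localGroundProj Φ univ)
    {E : ℕ → ℝ} (hE0 : ∀ m, 0 ≤ E m)
    (hcent : ∀ (u : TorusSite d L) (m : ℕ), ‖Y u - twirl (cellBall u (r₀ + m))ᶜ (Y u)‖ ≤ E m)
    {δ₀ N : ℝ} (hδ₀ : ∀ u, ‖localGroundProj Φ univ * Y u * localGroundProj Φ univ‖ ≤ δ₀)
    (hN : ∀ u, ‖Y u‖ ≤ N) (x : EuclideanSpace ℂ (TensorIndex (TorusSite d L × κ) q)) :
    ‖⟪x, toEuclideanLin (∑ u : TorusSite d L, ∑ p ∈ range (M + 1), ∑ r ∈ range (M + 1),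
        (if p = 0 then 1 - localGroundProj Φ (cellBall u (r₀ + 0)) else
          localGroundProj Φ (cellBall u (r₀ + (p - 1))) - localGroundProj Φ (cellBall u (r₀ + p))) * Y u *
        (if r = 0 then 1 - localGroundProj Φ (cellBall u (r₀ + 0)) else
          localGroundProj Φ (cellBall u (r₀ + (r - 1))) - localGroundProj Φ (cellBall u (r₀ + r)))) x⟫_ℂ‖ ≤
      (∑ j ∈ range (M + 1), (2 * (j : ℝ) + 2) * (((2 * (r₀ + j) + 1) ^ d : ℕ) : ℝ) *
        ((if j = 0 then 2 * N else
          2 * (δ₀ + 2 * E ((j - 1) / 2) + N * Real.sqrt (2 * Δ (j - 1 - (j - 1) / 2)))) / γloc (r₀ + j))) *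
      RCLike.re ⟪x, toEuclideanLin (localHamiltonian Φ univ) x⟫_ℂ := by
  -- notation for the shell pieces and the bound
  set piece : TorusSite d L → ℕ → ℕ → Op (TorusSite d L × κ) q := fun u p r =>
    (if p = 0 then 1 - localGroundProj Φ (cellBall u (r₀ + 0)) else
      localGroundProj Φ (cellBall u (r₀ + (p - 1))) - localGroundProj Φ (cellBall u (r₀ + p))) * Y u *
    (if r = 0 then 1 - localGroundProj Φ (cellBall u (r₀ + 0)) else
      localGroundProj Φ (cellBall u (r₀ + (r - 1))) - localGroundProj Φ (cellBall u (r₀ + r))) with hpiece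
  set bnd : ℕ → ℝ := fun j => (if j = 0 then 2 * N else
    2 * (δ₀ + 2 * E ((j - 1) / 2) + N * Real.sqrt (2 * Δ (j - 1 - (j - 1) / 2)))) with hbnd
  have hN0 : 0 ≤ N := (norm_nonneg _).trans (hN (Classical.arbitrary _))
  have hδ₀0 : 0 ≤ δ₀ := (norm_nonneg _).trans (hδ₀ (Classical.arbitrary _))
  have hbnd0 : ∀ j, 0 ≤ bnd j := fun j => by
    simp only [hbnd]
    split_ifs
    · linarith
    · have h1 := hE0 ((j - 1) / 2)
      have h2 : 0 ≤ N * Real.sqrt (2 * Δ (j - 1 - (j - 1) / 2)) := mul_nonneg hN0 (Real.sqrt_nonneg _)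
      linarith
  set H0 : ℝ := RCLike.re ⟪x, toEuclideanLin (localHamiltonian Φ univ) x⟫_ℂ with hH0
  have hH00 : 0 ≤ H0 := re_inner_toEuclideanLin_nonneg (hΦ.posSemidef_localHamiltonian univ) x
  -- Step 1: each piece's form is controlled by the local gap of `b_u(r₀ + max p r)`
  have hstep1 : ∀ (u : TorusSite d L) (p r : ℕ),
      ‖⟪x, toEuclideanLin (piece u p r) x⟫_ℂ‖ ≤
        bnd (max p r) / γloc (r₀ + max p r) *
          RCLike.re ⟪x, toEuclideanLin (localHamiltonian Φ (cellBall u (r₀ + max p r))) x⟫_ℂ := by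
    intro u p r
    set j := max p r with hj
    obtain ⟨hQn, hQn'⟩ := localGroundProj_chain_nested Φ u r₀
    have hWP : piece u p r * localGroundProj Φ (cellBall u (r₀ + j)) = 0 :=
      doubleShell_mul_proj_eq_zero (Q := fun k => localGroundProj Φ (cellBall u (r₀ + k))) hQn'
        (le_max_right p r) (Y u)
    have hPW : localGroundProj Φ (cellBall u (r₀ + j)) * piece u p r = 0 :=
      proj_mul_doubleShell_eq_zero (Q := fun k => localGroundProj Φ (cellBall u (r₀ + k))) hQn
        (le_max_left p r) (Y u)
    have hnorm : ‖piece u p r‖ ≤ bnd j :=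
      norm_shellPiece_le hLTQO hΔ0 hP0 (hY u) (hcomm u) hE0 (hcent u) (hδ₀ u) (hN u) p r
    have h1 := norm_inner_toEuclideanLin_le_of_mul_proj_eq_zero
      (localGroundProj_isHermitian Φ (cellBall u (r₀ + j))) hWP hPW x
    have h2 := hΦ.re_inner_localHamiltonian_ge (hgap u (r₀ + j)) x
    have hγj := hγ (r₀ + j)
    calc ‖⟪x, toEuclideanLin (piece u p r) x⟫_ℂ‖
        ≤ ‖piece u p r‖ * ‖x - toEuclideanLin (localGroundProj Φ (cellBall u (r₀ + j))) x‖ ^ 2 := h1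
      _ ≤ bnd j * ‖x - toEuclideanLin (localGroundProj Φ (cellBall u (r₀ + j))) x‖ ^ 2 :=
          mul_le_mul_of_nonneg_right hnorm (sq_nonneg _)
      _ = bnd j / γloc (r₀ + j) *
          (γloc (r₀ + j) * ‖x - toEuclideanLin (localGroundProj Φ (cellBall u (r₀ + j))) x‖ ^ 2) := by
          field_simp
      _ ≤ bnd j / γloc (r₀ + j) * _ :=
          mul_le_mul_of_nonneg_left h2 (div_nonneg (hbnd0 j) hγj.le)
  -- Step 2: sum over the centres at a fixed radius, using the covering multiplicity
  have hstep2 : ∀ j : ℕ, ∑ u : TorusSite d L,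
      RCLike.re ⟪x, toEuclideanLin (localHamiltonian Φ (cellBall u (r₀ + j))) x⟫_ℂ ≤
        (((2 * (r₀ + j) + 1) ^ d : ℕ) : ℝ) * H0 := by
    intro j
    refine sum_re_inner_localHamiltonian_le hΦ univ (fun u => cellBall u (r₀ + j)) (fun Z hZ => ?_) x
    have hZne : Z.Nonempty := by
      rw [Finset.nonempty_iff_ne_empty]; rintro rfl; exact hZ hΦ0
    exact card_filter_subset_cellBall_le hZne (r₀ + j)
  -- Step 3: assemble
  have htri : ‖⟪x, toEuclideanLin (∑ u : TorusSite d L, ∑ p ∈ range (M + 1), ∑ r ∈ range (M + 1),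
      piece u p r) x⟫_ℂ‖ ≤ ∑ u : TorusSite d L, ∑ p ∈ range (M + 1), ∑ r ∈ range (M + 1),
        ‖⟪x, toEuclideanLin (piece u p r) x⟫_ℂ‖ := by
    simp only [map_sum, LinearMap.sum_apply, inner_sum]
    refine (norm_sum_le _ _).trans (sum_le_sum fun u _ => ?_)
    refine (norm_sum_le _ _).trans (sum_le_sum fun p _ => ?_)
    exact norm_sum_le _ _
  refine htri.trans ?_
  calc ∑ u : TorusSite d L, ∑ p ∈ range (M + 1), ∑ r ∈ range (M + 1), ‖⟪x, toEuclideanLin (piece u p r) x⟫_ℂ‖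
      ≤ ∑ u : TorusSite d L, ∑ p ∈ range (M + 1), ∑ r ∈ range (M + 1),
          bnd (max p r) / γloc (r₀ + max p r) *
            RCLike.re ⟪x, toEuclideanLin (localHamiltonian Φ (cellBall u (r₀ + max p r))) x⟫_ℂ :=
        sum_le_sum fun u _ => sum_le_sum fun p _ => sum_le_sum fun r _ => hstep1 u p r
    _ = ∑ p ∈ range (M + 1), ∑ r ∈ range (M + 1), (bnd (max p r) / γloc (r₀ + max p r) *
          ∑ u : TorusSite d L,
            RCLike.re ⟪x, toEuclideanLin (localHamiltonian Φ (cellBall u (r₀ + max p r))) x⟫_ℂ) := by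
        rw [sum_comm]
        refine sum_congr rfl fun p _ => ?_
        rw [sum_comm]
        refine sum_congr rfl fun r _ => ?_
        rw [mul_sum]
    _ ≤ ∑ p ∈ range (M + 1), ∑ r ∈ range (M + 1), (bnd (max p r) / γloc (r₀ + max p r) *
          ((((2 * (r₀ + max p r) + 1) ^ d : ℕ) : ℝ) * H0)) :=
        sum_le_sum fun p _ => sum_le_sum fun r _ =>
          mul_le_mul_of_nonneg_left (hstep2 _) (div_nonneg (hbnd0 _) (hγ _).le)
    _ ≤ ∑ j ∈ range (M + 1), (2 * (j : ℝ) + 2) * (bnd j / γloc (r₀ + j) *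
          ((((2 * (r₀ + j) + 1) ^ d : ℕ) : ℝ) * H0)) :=
        sum_sum_max_le (g := fun j => bnd j / γloc (r₀ + j) * ((((2 * (r₀ + j) + 1) ^ d : ℕ) : ℝ) * H0))
          (fun j => mul_nonneg (div_nonneg (hbnd0 j) (hγ _).le) (mul_nonneg (Nat.cast_nonneg _) hH00)) M
    _ = (∑ j ∈ range (M + 1), (2 * (j : ℝ) + 2) * (((2 * (r₀ + j) + 1) ^ d : ℕ) : ℝ) *
          (bnd j / γloc (r₀ + j))) * H0 := by
        rw [sum_mul]; refine sum_congr rfl fun j _ => by ring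

end ShellRelativeBoundMain

end Literature.MathematicalPhysics.QuantumLattice
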